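import Mathlib
import Literature.Analysis.FluidPDE.SelfSimilarEulerStagnationStretching
import Literature.Analysis.FluidPDE.SelfSimilarEulerTrappedTrajectories
import Literature.Analysis.ODE.LipschitzFlow
import Literature.Analysis.ODE.MaxLyapunovInvariance
import HarnessLib.Audit

/-!
# Rung C1 of the crux `EulerZoomLiouville.PowerGaugeEulerLiouville`: BACKWARD self-similar
# trajectories of an in-window profile are bounded and, when the nodal set is finite, converge to a
# single stagnation point

Route №10 `EulerZoomLiouville` (NavierStokesRegularity), crux E = stmt-NavierStokesRegularity-19832,
tenure rung C1, registered residue `stub_selfSimilarExtremal`.  Third file of the NODAL-FINITENESS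
chain (lineage ns-typeII-p2, gen 6).  For a `C²` self-similar Euler profile `(U, P)` (CIV 2026 (3.3))
with exponent `γ > 0` and the far-field bounds (3.8) (`HasSelfSimilarFarFieldWith γ c C U`):

* `norm_fderiv_le_of_farField`, `norm_curl_le_of_farField`, `lipschitzWith_transport` — (3.8) makes
  `DU`, `curl U` bounded by `C` and the transport field `V = γ(y−c) + U` globally Lipschitz, so the
  self-similar Lagrangian flow `Φ = lipschitzFlow` is global (tree `Literature.Analysis.ODE.lipschitzFlow`);
  `hasDerivAt_backwardFlow`: `t ↦ Φ_{−t}(x)` solves `Y' = −V(Y)`; `continuous_flow_slice`.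
* `backward_orbit_bounded` — **every backward trajectory is bounded** (CIV §3.5, first paragraph of
  the proof of Thm 3.10: outside a large ball the transport is outward, `⟪V(y), y−c⟫ ≥ (γ/2)|y−c|²`,
  tree `HasSelfSimilarFarFieldWith.exists_inner_transport_ge`; barrier `|y−c|²`, tree
  `Literature.Analysis.ODE.forall_le_of_solution_of_active_lt`).
* `tendsto_of_transport_comp_tendsto_zero_of_finite` — a bounded curve along which `V → 0`, whose
  cluster point `z` is an ISOLATED zero of `V` among finitely many, converges to `z` (intermediate
  value argument on `dist(Y, z)`).
* `exists_tendsto_backward_orbit` — **for `γ < ½` (indeed `γ ≠ ½`) and a FINITE nodal set, every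
  backward trajectory converges to a stagnation point** (Barbalat along trapped trajectories, tree
  `IsSelfSimilarEulerProfile.exists_mem_nodalSet_mapClusterPt_of_bounded` of the p3 lineage, plus the
  previous item).

WHAT THIS IS NOT: not NS, not E, not rung C1 — Lagrangian bookkeeping for classical profiles with
CIV's far field.

## References

* P. Constantin, M. Ignatova, V. Vicol, arXiv:2602.17570 (2026), §3.1.3 (3.8), §3.4.3 (3.31)–(3.33),
  §3.5 proof of Thm 3.10. [ConstantinIgnatovaVicol2026Putative]
-/

noncomputable section

-- flat `Theorems/<Route><Decl>…` files of one crux share the namespace of the crux (tree convention)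
set_option linter.dupNamespace false

open Set Filter Topology Metric Function InnerProductSpace
open scoped RealInnerProductSpace NNReal

namespace Summit.NavierStokesRegularity.NavierStokesRegularity.Theorems.PowerGaugeEulerLiouville.NodalFiniteness

open Literature.Analysis Literature.Analysis.FluidPDE Literature.Analysis.ODE

variable {γ C : ℝ} {c : EuclideanSpace ℝ (Fin 3)}
  {U : EuclideanSpace ℝ (Fin 3) → EuclideanSpace ℝ (Fin 3)} {P : EuclideanSpace ℝ (Fin 3) → ℝ}

/-! ### Bounds from the far field (3.8) and the global flow -/

/-- The decay factor of (3.8) is at most `1`: `(1 + r²)^{−1/(2γ)} ≤ 1` for `γ > 0`.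
[cite: ConstantinIgnatovaVicol2026Putative, §3.1.3 eq. (3.8)] -/
private theorem decayFactor_le_one (hγ : 0 < γ) (r : ℝ) :
    (1 + r ^ 2) ^ (-(1 / (2 * γ))) ≤ (1 : ℝ) :=
  Real.rpow_le_one_of_one_le_of_nonpos (by nlinarith [sq_nonneg r])
    (by have : 0 < 1 / (2 * γ) := by positivity
        linarith)

/-- (3.8) ⇒ `‖DU‖ ≤ C♭` everywhere. [cite: ConstantinIgnatovaVicol2026Putative, §3.1.3 eq. (3.8)] -/
theorem norm_fderiv_le_of_farField (hγ : 0 < γ) (hfar : HasSelfSimilarFarFieldWith γ c C U)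
    (y : EuclideanSpace ℝ (Fin 3)) : ‖fderiv ℝ U y‖ ≤ C :=
  (hfar.norm_fderiv_le y).trans (mul_le_of_le_one_right hfar.nonneg (decayFactor_le_one hγ _))

/-- (3.8) ⇒ `‖curl U‖ ≤ C♭` everywhere. [cite: ConstantinIgnatovaVicol2026Putative, §3.1.3 eq. (3.8)] -/
theorem norm_curl_le_of_farField (hγ : 0 < γ) (hfar : HasSelfSimilarFarFieldWith γ c C U)
    (y : EuclideanSpace ℝ (Fin 3)) : ‖curl U y‖ ≤ C :=
  (hfar.norm_curl_le y).trans (mul_le_of_le_one_right hfar.nonneg (decayFactor_le_one hγ _))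

/-- (3.8) ⇒ the transport field `V = γ(y−c) + U` is globally Lipschitz with constant `|γ| + C♭`.
[cite: ConstantinIgnatovaVicol2026Putative, §3.4 eq. (3.19) with §3.1.3 eq. (3.8)] -/
theorem lipschitzWith_transport (h : IsSelfSimilarEulerProfile γ c U P) (hγ : 0 < γ)
    (hfar : HasSelfSimilarFarFieldWith γ c C U) :
    LipschitzWith (Real.toNNReal (|γ| + C)) (selfSimilarTransport γ c U) := by
  have hUd := h.differentiable_velocity
  have hVd : Differentiable ℝ (selfSimilarTransport γ c U) :=
    fun y => (hasFDerivAt_selfSimilarTransport hUd y).differentiableAt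
  refine lipschitzWith_of_nnnorm_fderiv_le hVd fun y => ?_
  rw [← NNReal.coe_le_coe, coe_nnnorm, Real.coe_toNNReal _ (add_nonneg (abs_nonneg γ) hfar.nonneg),
    (hasFDerivAt_selfSimilarTransport hUd y).fderiv]
  refine (norm_add_le _ _).trans (add_le_add ?_ (norm_fderiv_le_of_farField hγ hfar y))
  rw [norm_smul, Real.norm_eq_abs]
  exact mul_le_of_le_one_right (abs_nonneg γ) ContinuousLinearMap.norm_id_le

/-- The backward flow curve `t ↦ Φ_{−t}(x)` solves `Y' = −V(Y)`.
[cite: ConstantinIgnatovaVicol2026Putative, §3.4.1 eq. (3.21)] -/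
theorem hasDerivAt_backwardFlow {K : ℝ≥0} (hK : LipschitzWith K (selfSimilarTransport γ c U))
    (x : EuclideanSpace ℝ (Fin 3)) (t : ℝ) :
    HasDerivAt (fun s => lipschitzFlow hK x (-s))
      ((-1 : ℝ) • selfSimilarTransport γ c U (lipschitzFlow hK x (-t))) t :=
  (hasDerivAt_lipschitzFlow hK x (-t)).scomp t (hasDerivAt_neg t)

/-- Each time-slice `x ↦ Φ_t(x)` of the flow of the (`C¹`, Lipschitz) transport field is continuous.
[cite: ConstantinIgnatovaVicol2026Putative, §3.4.1 eq. (3.21)] -/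
theorem continuous_flow_slice (h : IsSelfSimilarEulerProfile γ c U P) {K : ℝ≥0}
    (hK : LipschitzWith K (selfSimilarTransport γ c U)) (t : ℝ) :
    Continuous fun x : EuclideanSpace ℝ (Fin 3) => lipschitzFlow hK x t := by
  have hV1 : ContDiff ℝ 1 (selfSimilarTransport γ c U) := by
    have e : selfSimilarTransport γ c U = fun y => γ • (y - c) + U y := rfl
    rw [e]
    exact ((contDiff_id.sub contDiff_const).const_smul γ).add (h.contDiff_velocity.of_le (by norm_num))
  exact (contDiff_lipschitzFlow hV1 le_rfl hK).continuous.comp (Continuous.prodMk_left t)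

/-! ### Backward trajectories are bounded -/

/-- **Every backward self-similar trajectory is bounded** (`γ > 0`, far field (3.8)).  With `R` the
radius beyond which `⟪V(y), y−c⟫ ≥ (γ/2)|y−c|²` (tree `exists_inner_transport_ge`), the quantity
`|Y − c|²` cannot increase through any level `≥ R²` along `Y' = −V(Y)`, so
`|Y(t) − c|² ≤ max(|Y(0) − c|², R²)` for all `t ≥ 0`.
[cite: ConstantinIgnatovaVicol2026Putative, §3.5 proof of Thm 3.10 (first paragraph)] -/
theorem backward_orbit_bounded (hγ : 0 < γ)
    (hfar : HasSelfSimilarFarFieldWith γ c C U) {Y : ℝ → EuclideanSpace ℝ (Fin 3)}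
    (hY : ∀ t, HasDerivAt Y ((-1 : ℝ) • selfSimilarTransport γ c U (Y t)) t) :
    ∃ B : ℝ, ∀ t, 0 ≤ t → ‖Y t‖ ≤ B := by
  obtain ⟨R, hR, hout⟩ := hfar.exists_inner_transport_ge hγ
  set c₀ : ℝ := max (‖Y 0 - c‖ ^ 2) (R ^ 2) with hc₀
  have hc₀R : R ^ 2 ≤ c₀ := le_max_right _ _
  have hc₀pos : 0 < c₀ := lt_of_lt_of_le (by positivity) hc₀R
  -- the barrier functional `g y = ‖y - c‖²` with derivative `2⟪y - c, ·⟫`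
  set g : Unit → EuclideanSpace ℝ (Fin 3) → ℝ := fun _ y => ‖y - c‖ ^ 2 with hg
  set g' : Unit → EuclideanSpace ℝ (Fin 3) → EuclideanSpace ℝ (Fin 3) →L[ℝ] ℝ :=
    fun _ y => 2 • (innerSL ℝ (y - c)).comp (ContinuousLinearMap.id ℝ _) with hg'
  have hgd : ∀ k y, HasFDerivAt (g k) (g' k y) y := fun _ y =>
    ((hasFDerivAt_id y).sub_const c).norm_sq
  set F : EuclideanSpace ℝ (Fin 3) → EuclideanSpace ℝ (Fin 3) :=
    fun y => (-1 : ℝ) • selfSimilarTransport γ c U y with hF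
  have hface : ∀ y, (∀ j, g j y ≤ (fun _ => c₀) j) → ∀ k, g k y = (fun _ => c₀) k →
      g' k y (F y) < 0 := by
    intro y _ k hk
    simp only [hg] at hk
    have hyR : R ≤ ‖y - c‖ := by
      have h1 : R ^ 2 ≤ ‖y - c‖ ^ 2 := hk ▸ hc₀R
      exact (pow_le_pow_iff_left₀ hR.le (norm_nonneg _) two_ne_zero).1 h1
    have hVy := hout y hyR
    rw [real_inner_comm] at hVy
    have hpos : 0 < γ / 2 * ‖y - c‖ ^ 2 := by
      have : 0 < ‖y - c‖ := lt_of_lt_of_le hR hyR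
      positivity
    have hval : g' k y (F y) = -((2 : ℝ) * ⟪y - c, selfSimilarTransport γ c U y⟫) := by
      show (2 • (innerSL ℝ (y - c)).comp (ContinuousLinearMap.id ℝ _))
          ((-1 : ℝ) • selfSimilarTransport γ c U y) = _
      rw [smul_apply, ContinuousLinearMap.comp_apply, ContinuousLinearMap.id_apply,
        innerSL_apply_apply, inner_smul_right, nsmul_eq_mul]
      push_cast
      ring
    rw [hval]
    linarith
  refine ⟨‖c‖ + Real.sqrt c₀, fun t ht => ?_⟩
  have hsol : ∀ s ∈ Icc 0 t, HasDerivWithinAt Y (F (Y s)) (Icc 0 t) s :=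
    fun s _ => (hY s).hasDerivWithinAt
  have h0 : ∀ k, g k (Y 0) ≤ (fun _ => c₀) k := fun _ => le_max_left _ _
  have hle := forall_le_of_solution_of_active_lt hgd hface hsol h0 t ⟨ht, le_rfl⟩ ()
  simp only [hg] at hle
  have h1 : ‖Y t - c‖ ≤ Real.sqrt c₀ := Real.le_sqrt_of_sq_le hle
  calc ‖Y t‖ = ‖(Y t - c) + c‖ := by rw [sub_add_cancel]
    _ ≤ ‖Y t - c‖ + ‖c‖ := norm_add_le _ _
    _ ≤ ‖c‖ + Real.sqrt c₀ := by linarith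

/-! ### Convergence to an isolated zero of `V` -/

/-- **A bounded curve along which `V → 0` converges to its cluster point, if the zeros of `V` in the
confining ball are finite.**  Let `V` be continuous with finitely many zeros, `Y` a continuous curve
with `‖Y(t)‖ ≤ B` for `t ≥ 0` and `V(Y(t)) → 0`, and let `z` be a cluster point of `Y` (necessarily a
zero of `V`).
Then `Y(t) → z`.  (If `Y` left the ball `B(z, ε)` after time `t₁`, the intermediate value theorem
would put it on the sphere `dist = ε`, where — away from all zeros — `‖V‖` has a positive lower
bound, contradicting `V(Y) → 0`.) [folklore] -/
theorem tendsto_of_transport_comp_tendsto_zero_of_finite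
    {V : EuclideanSpace ℝ (Fin 3) → EuclideanSpace ℝ (Fin 3)} (hVc : Continuous V)
    (hfin : {y | V y = 0}.Finite) {Y : ℝ → EuclideanSpace ℝ (Fin 3)} (hYc : Continuous Y)
    {B : ℝ} (hB : ∀ t, 0 ≤ t → ‖Y t‖ ≤ B)
    (hV0 : Tendsto (fun t => V (Y t)) atTop (𝓝 0))
    {z : EuclideanSpace ℝ (Fin 3)} (hcl : MapClusterPt z atTop Y) :
    Tendsto Y atTop (𝓝 z) := by
  -- isolation radius `r`: the other zeros are at distance `≥ r` from `z`
  have hclosed : IsClosed ({y | V y = 0} \ {z}) := (hfin.subset fun _ hx => hx.1).isClosed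
  have hzmem : z ∈ ({y | V y = 0} \ {z})ᶜ := fun hmem => hmem.2 rfl
  obtain ⟨r, hr, hball⟩ := Metric.isOpen_iff.1 hclosed.isOpen_compl z hzmem
  have hsep : ∀ z', V z' = 0 → z' ≠ z → r ≤ dist z' z := by
    intro z' hz' hne
    by_contra hlt
    push Not at hlt
    exact hball (mem_ball.2 hlt) ⟨hz', hne⟩
  rw [Metric.tendsto_atTop]
  intro ε hε
  -- work with `ε' = min ε (r/3)`
  set ε' : ℝ := min ε (r / 3) with hε'
  have hε'pos : 0 < ε' := lt_min hε (by positivity)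
  have hε'r : 3 * ε' ≤ r := by
    have := min_le_right ε (r / 3); rw [← hε'] at this; linarith
  -- the compact set `K` where the curve may not be after large times
  set K : Set (EuclideanSpace ℝ (Fin 3)) :=
    closedBall 0 B ∩ {y | ε' ≤ dist y z ∧ dist y z ≤ 2 * ε'} with hK
  have hKc : IsCompact K := by
    refine (isCompact_closedBall 0 B).inter_right ?_
    exact (isClosed_le continuous_const (continuous_id.dist continuous_const)).inter
      (isClosed_le (continuous_id.dist continuous_const) continuous_const)
  have hVpos : ∀ y ∈ K, 0 < ‖V y‖ := by
    rintro y ⟨_, hy1, hy2⟩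
    rw [norm_pos_iff]
    intro hVy
    by_cases hyz : y = z
    · rw [hyz, dist_self] at hy1; linarith
    · have := hsep y hVy hyz; linarith
  obtain ⟨m₀, hm₀, hKle⟩ := hKc.exists_forall_le' hVc.norm.continuousOn hVpos
  -- eventually `‖V (Y t)‖ < m₀`, so `Y t ∉ K`
  have hev : ∀ᶠ t in atTop, ‖V (Y t)‖ < m₀ := by
    have := (tendsto_zero_iff_norm_tendsto_zero.1 hV0).eventually (Iio_mem_nhds hm₀)
    exact this
  obtain ⟨T, hT⟩ := (hev.and (eventually_ge_atTop 0)).exists_forall_of_atTop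
  -- a time `t₁ ≥ T` with `dist (Y t₁) z < ε'` (cluster point)
  have hfreq : ∃ᶠ t in atTop, Y t ∈ ball z ε' := hcl.frequently (ball_mem_nhds z hε'pos)
  obtain ⟨t₁, ht₁, ht₁T⟩ := (hfreq.and_eventually (eventually_ge_atTop T)).exists
  refine ⟨t₁, fun t ht => ?_⟩
  have htT : T ≤ t := ht₁T.trans ht
  -- suppose `dist (Y t) z ≥ ε'`; IVT gives `s ∈ [t₁, t]` with `dist (Y s) z = ε'`
  by_contra hge
  push Not at hge
  have hcont : ContinuousOn (fun s => dist (Y s) z) (Icc t₁ t) :=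
    (hYc.dist continuous_const).continuousOn
  have hmem : ε' ∈ Icc (dist (Y t₁) z) (dist (Y t) z) :=
    ⟨(mem_ball.1 ht₁).le, (min_le_left _ _).trans hge⟩
  obtain ⟨s, hs, hsε⟩ := intermediate_value_Icc ht hcont hmem
  have hsT : T ≤ s := ht₁T.trans hs.1
  have hs0 : 0 ≤ s := (hT s hsT).2
  have hYsK : Y s ∈ K := by
    refine ⟨mem_closedBall_zero_iff.2 (hB s hs0), ?_, ?_⟩
    · simp only at hsε; exact hsε.ge
    · simp only at hsε; linarith
  have h1 := hKle (Y s) hYsK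
  have h2 := (hT s hsT).1
  linarith

/-! ### Finite nodal set: every backward trajectory converges to a node -/

/-- **Backward trajectories converge to stagnation points** when the nodal set is finite.  Let
`0 < γ`, `γ ≠ ½`, `(U, P)` a `C²` profile with far field (3.8) whose nodal set
`𝒩_V = {V = 0}` is finite, and `Y` a backward trajectory (`Y' = −V(Y)`).  Then `Y(t) → z` for some
`z ∈ 𝒩_V`: `Y` is bounded (`backward_orbit_bounded`), so `V(Y(t)) → 0` and `Y` accumulates at a
node (Barbalat, tree `exists_mem_nodalSet_mapClusterPt_of_bounded`), and an isolated node that is a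
cluster point is the limit (`tendsto_of_transport_comp_tendsto_zero_of_finite`).
[cite: ConstantinIgnatovaVicol2026Putative, §3.4.3 eq. (3.33), §3.5 proof of Thm 3.10] -/
theorem exists_tendsto_of_backward_trajectory (h : IsSelfSimilarEulerProfile γ c U P) (hγ : 0 < γ)
    (hγ' : γ ≠ 1 / 2) (hfar : HasSelfSimilarFarFieldWith γ c C U)
    (hfin : (selfSimilarNodalSet γ c U).Finite) {Y : ℝ → EuclideanSpace ℝ (Fin 3)}
    (hY : ∀ t, HasDerivAt Y ((-1 : ℝ) • selfSimilarTransport γ c U (Y t)) t) :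
    ∃ z ∈ selfSimilarNodalSet γ c U, Tendsto Y atTop (𝓝 z) := by
  obtain ⟨B, hB⟩ := backward_orbit_bounded hγ hfar hY
  obtain ⟨z, hzN, _, hcl⟩ :=
    h.exists_mem_nodalSet_mapClusterPt_of_bounded hγ' (by norm_num : (-1 : ℝ) ≠ 0) hY hB
  have hV0 := h.tendsto_transport_comp_of_bounded hγ' (by norm_num : (-1 : ℝ) ≠ 0) hY hB
  have hVc : Continuous (selfSimilarTransport γ c U) := by
    have e : selfSimilarTransport γ c U = fun y => γ • (y - c) + U y := rfl
    rw [e]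
    exact ((continuous_id.sub continuous_const).const_smul γ).add h.contDiff_velocity.continuous
  have hfin' : {y | selfSimilarTransport γ c U y = 0}.Finite := by
    have e : {y | selfSimilarTransport γ c U y = 0} = selfSimilarNodalSet γ c U := by
      ext y; rw [mem_setOf_eq, mem_selfSimilarNodalSet_iff, selfSimilarTransport_apply]
    rw [e]; exact hfin
  have hYc : Continuous Y := continuous_iff_continuousAt.2 fun t => (hY t).continuousAt
  exact ⟨z, hzN, tendsto_of_transport_comp_tendsto_zero_of_finite hVc hfin' hYc hB hV0 hcl⟩

/-- The flow form: for every `x`, the backward orbit `t ↦ Φ_{−t}(x)` converges to a node.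
[cite: ConstantinIgnatovaVicol2026Putative, §3.5 proof of Thm 3.10] -/
theorem exists_tendsto_backward_orbit (h : IsSelfSimilarEulerProfile γ c U P) (hγ : 0 < γ)
    (hγ' : γ ≠ 1 / 2) (hfar : HasSelfSimilarFarFieldWith γ c C U)
    (hfin : (selfSimilarNodalSet γ c U).Finite) {K : ℝ≥0}
    (hK : LipschitzWith K (selfSimilarTransport γ c U)) (x : EuclideanSpace ℝ (Fin 3)) :
    ∃ z ∈ selfSimilarNodalSet γ c U, Tendsto (fun t => lipschitzFlow hK x (-t)) atTop (𝓝 z) :=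
  exists_tendsto_of_backward_trajectory h hγ hγ' hfar hfin (hasDerivAt_backwardFlow hK x)

end Summit.NavierStokesRegularity.NavierStokesRegularity.Theorems.PowerGaugeEulerLiouville.NodalFiniteness
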